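import Literature.NumberTheory.EllipticCurves.Rank1Residual.ClassX1KellerYin
import Literature.NumberTheory.EllipticCurves.Rank1Residual.GVParityTwistProofs
import Literature.NumberTheory.EllipticCurves.GreenbergVatsal2000.IwasawaInvariants
import Literature.NumberTheory.EllipticCurves.IwasawaLeadingTerm
import Literature.NumberTheory.EllipticCurves.HeegnerHypothesisKroneckerProofs
import Literature.NumberTheory.QuadraticFields.FundamentalDiscriminant
import HarnessLib

/-!
# Class X1 ∩ {r = 1} of parity type A: `BSD(E,p)` modulo EXACTLY Keller–Yin's two preprint theorems

HONEST FRAMING (cell `b2b-bsdres`, home `run/shared/lean/b2b/bsd-rank1-residual/`). The goal is to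
DELETE the COMBINATION-SHAPED residual classes for ALL analytic-rank `≤ 1` curves over `ℚ` from
PUBLISHED theorems only, and to TYPE the rest; this is not "finishing BSD". Third file of the
Keller–Yin route for class X1 (Eisenstein anomalous good `p`; audit `b2b-bsdres-x1a/X1-CHAIN.md`):
in `Rank1Residual/ClassX1KellerYin.lean` the rank-one class theorem
`bsdp_of_classX1_of_analyticRank_eq_one_of_KY_OPEN` carried, besides Keller–Yin's rank-one display
(`hKY_OPEN`), the "partner" input `hpartner` — the rank-`0` print shape of the admissible twist `E^K`
([CGLS] Thm. 5.1.4 for `E^K`). Here that input is DISCHARGED on the sub-class of parity type A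
(`¬ GVPar W p`: no rational `p`-isogeny kernel of type (ramified ∧ even) ∨ (unramified ∧ odd) — e.g.
a rational `p`-torsion point), from PUBLISHED named facts only:

* Greenberg–Vatsal 2000 Thm. (1.3) + (1.2) (`GreenbergVatsal2000.thm13_charIdeal_eq_of_gvPar`:
  Mazur's (MC) under (GV), Néron normalisation) applied to a global minimal model `Wd` of `E^K`,
  which satisfies (GV) by the twist-parity lemma `gvPar_of_not_gvPar_of_twist`
  (`Rank1Residual/GVParityTwistProofs.lean`, PROVED: `χ_K` is odd and unramified at `p`) and is good
  ordinary at `p` (`isOrdinaryAt_of_smul_eq_quadraticTwist`, PROVED: `p ∤ 2 d_K`);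
* Greenberg LNM 1716 Thm. 4.1 (`greenberg_charValue_rankZero`), Mazur–Swinnerton-Dyer interpolation
  (tree theorem) and modularity (`nonempty_modularParametrizationData`), through the glue
  `padicValRat_bsd_rank_zero_of_mazurMainConjecture` ([CGLS] Thm. 5.1.4's proof).

Result `bsdp_of_classX1_typeA_of_analyticRank_eq_one_of_KY_OPEN`: for `W/ℚ` globally minimal
elliptic, `ClassX1 W p`, `¬ GVPar W p`, `ord_{s=1} L(E,s) = 1`: Miller's `BSD(E,p)` follows from the
PUBLISHED named facts above plus Gross–Zagier I.7.3, Hoffstein–Luo, Gross–Zagier–Kolyvagin,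
modularity — and ONE open hypothesis, Keller–Yin's rank-one display (`hKY_OPEN`, the `∀`-form of
`KellerYin2024.thm421_rankOne_display_OPEN`; its unpublished links are KY Thm. 3.0.11 (IMC2) and
Thm. 7.0.6 (anticyclotomic control with torsion), arXiv:2402.12781v2). So the sub-class
X1a := X1 ∩ {r = 1, type A} is conditional on exactly those two announced theorems and nothing else
unpublished; X1 ∩ {r = 0} and X1 ∩ {r = 1, type B} rest moreover on Mazur's (MC) at an anomalous
prime of type A (`Rank1ResidualX1Defs.MazurMainConjectureOnX1TypeA`), unstated in print.

References: [KellerYin2024] Thm. 4.2.1 and proof (p. 22); [CastellaEtAl2021] Thms. 5.1.4, 5.3.1;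
[GreenbergVatsal2000] Thm. (1.3); [GreenbergLNM1716] Thm. 4.1; [Knapp1993] Prop. 12.10.
-/

set_option autoImplicit false

noncomputable section

open scoped Classical MatrixGroups ModularForm

open CongruenceSubgroup WeierstrassCurve Literature.NumberTheory.EllipticCurves
  Literature.NumberTheory.EllipticCurves.ModularForms Literature.NumberTheory.QuadraticFields

namespace Literature.NumberTheory.EllipticCurves.Rank1Residual

/-- For an imaginary quadratic field with odd discriminant, `d_K` is squarefree (a fundamental
discriminant `≡ 1 (mod 4)`; Cohen, *A Course in Computational Algebraic Number Theory*, Def. 5.1.2;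
tree `Quadratic.isFundamentalDiscriminant_discr`). [folklore] -/
theorem squarefree_discr_of_odd {K : Type} [Field K] [NumberField K] (hK : IsImaginaryQuadratic K)
    (hodd : Odd (NumberField.discr K)) : Squarefree (NumberField.discr K) := by
  rcases Quadratic.isFundamentalDiscriminant_discr (K := K) hK.1 with ⟨-, hsq, -⟩ | ⟨h4, -, -⟩
  · exact hsq
  · exfalso
    obtain ⟨k, hk⟩ := h4
    obtain ⟨m, hm⟩ := hodd
    omega

/-- A prime `p` that splits in `K` (`SatisfiesHeegnerHypothesis p K`) does not divide `d_K`, for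
`p` odd: the splitting condition is `(d_K/p) = 1` (`satisfiesHeegnerHypothesis_iff_kronecker`),
and the Jacobi symbol vanishes when `p ∣ d_K`. [folklore] -/
theorem not_dvd_discr_of_split {K : Type} [Field K] [NumberField K] (hK : IsImaginaryQuadratic K)
    {p : ℕ} (hp : p.Prime) (hp2 : p ≠ 2) (hsplit : SatisfiesHeegnerHypothesis p K) :
    ¬ (p : ℤ) ∣ NumberField.discr K := by
  have hj : jacobiSym (NumberField.discr K) p = 1 :=
    ((satisfiesHeegnerHypothesis_iff_kronecker p K hK.1).mp hsplit p hp dvd_rfl).2 hp2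
  intro hdvd
  haveI : NeZero p := ⟨hp.ne_zero⟩
  have h0 : jacobiSym (NumberField.discr K) p = 0 := by
    rw [jacobiSym.eq_zero_iff_not_coprime]
    intro hg
    have hpg : (p : ℤ) ∣ ((NumberField.discr K).gcd p : ℤ) :=
      Int.dvd_coe_gcd hdvd (dvd_refl _)
    rw [hg] at hpg
    have := Int.le_of_dvd one_pos hpg
    have h2 := hp.two_le
    omega
  rw [h0] at hj
  exact zero_ne_one hj

/-- **The partner input on type A, from PUBLISHED facts.** For `W/ℚ` globally minimal elliptic and
a class-X1 prime `p` with `¬ GVPar W p` (type A), every globally minimal model `Wd` of the twist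
`E^{(d_K)}` by an admissible field `K` (imaginary quadratic, `d_K` odd, `p` split, `L(E^K,1) ≠ 0`)
satisfies the rank-`0` print shape `PPartRankZero Wd p`: `Wd` is good ordinary at `p`
(`isOrdinaryAt_of_smul_eq_quadraticTwist`, `p ∤ 2d_K`), of parity type B
(`gvPar_of_not_gvPar_of_twist`), hence Mazur's (MC) holds for `(Wd, p)` by Greenberg–Vatsal
(`hGV`), and [CGLS] Thm. 5.1.4's proof (`padicValRat_bsd_rank_zero_of_mazurMainConjecture`, with
Greenberg's Thm. 4.1 `hGr`, modularity `hmodP`, Gross–Zagier–Kolyvagin `hGZK`) gives the print shape.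
[cite: CastellaEtAl2021, Thm. 5.1.4 and proof of Thm. 5.3.1] [cite: GreenbergVatsal2000, Thm. (1.3)] -/
theorem pPartRankZero_twist_of_not_gvPar (hGV : GreenbergVatsal2000.thm13_charIdeal_eq_of_gvPar)
    (hGr : greenberg_charValue_rankZero) (hmodP : nonempty_modularParametrizationData)
    (hGZK : rank_eq_analyticRank_of_analyticRank_le_one)
    (W : WeierstrassCurve ℚ) [W.IsElliptic] [W.IsGloballyMinimal] (p : ℕ) [Fact p.Prime]
    (hX1 : ClassX1 W p) (hA : ¬ GVPar W p)
    (K : Type) [Field K] [NumberField K] (hK : IsImaginaryQuadratic K)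
    (hodd : Odd (NumberField.discr K)) (hsplit : SatisfiesHeegnerHypothesis p K)
    (hLK : (W.quadraticTwist (NumberField.discr K : ℚ)).entireLFunction 1 ≠ 0)
    (Wd : WeierstrassCurve ℚ) [Wd.IsElliptic] [Wd.IsGloballyMinimal]
    (hWd : ∃ C : VariableChange ℚ, C • Wd = W.quadraticTwist (NumberField.discr K : ℚ)) :
    PPartRankZero Wd p := by
  have hp : p.Prime := Fact.out
  have hp2 : p ≠ 2 := by have := hX1.1; omega
  have hgood : W.HasGoodReductionAtPrime p := hX1.2.2.1
  have hred : ¬ W.HasIrreducibleModPGaloisRep p := hX1.2.1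
  have hord : ¬ (p : ℤ) ∣ W.frobeniusTrace p :=
    KellerYin2024.not_dvd_frobeniusTrace_of_anomalous W p hX1.2.2.2.1.2.2
  obtain ⟨C, hC⟩ := hWd
  have hdneg : NumberField.discr K < 0 := IsImaginaryQuadratic.discr_neg hK
  have hsqf : Squarefree (NumberField.discr K) := squarefree_discr_of_odd hK hodd
  have hpd : ¬ (p : ℤ) ∣ NumberField.discr K := not_dvd_discr_of_split hK hp hp2 hsplit
  -- `Wd` is good ordinary at `p` and of parity type B
  obtain ⟨hgood_d, hord_d⟩ :=
    isOrdinaryAt_of_smul_eq_quadraticTwist W Wd hsqf hC p hp2 hpd ⟨hgood, hord⟩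
  have hpar_d : GVPar Wd p := gvPar_of_not_gvPar_of_twist hp2 hred hA hdneg hpd Wd C hC
  -- `L(E^K,1) ≠ 0`, `Ш(E^K)` finite
  have hLd : Wd.entireLFunction 1 ≠ 0 := by
    rw [← Wd.entireLFunction_smul C, hC]
    exact hLK
  have hrd : Wd.analyticRank = 0 := analyticRank_eq_zero_of_entireLFunction_one_ne_zero hLd
  obtain ⟨-, hfin_d⟩ := hGZK Wd (by omega)
  -- Greenberg–Vatsal's main conjecture for `(Wd, p)` and the rank-`0` glue
  exact padicValRat_bsd_rank_zero_of_mazurMainConjecture Wd p hgood_d hord_d hLd hfin_d hmodP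
    (fun κ γ hκ hγ hγ' D _ hX fE hfE hSel ↦ hGr Wd p hp2 hgood_d hord_d κ γ hκ hγ hγ' D hX fE hfE hSel)
    (hGV Wd p hp2 hgood_d hord_d hpar_d)

/-- **X1 ∩ {r = 1, type A} ⇒ `BSD(E,p)` modulo exactly Keller–Yin's rank-one display.** For `W/ℚ`
globally minimal elliptic, `ClassX1 W p`, `¬ GVPar W p` (type A: e.g. `E` has a rational `p`-torsion
point at the good anomalous prime `p`) and `ord_{s=1} L(E,s) = 1`, Miller's `BSD(E,p)` follows from
the PUBLISHED named facts `GreenbergVatsal2000.thm13_charIdeal_eq_of_gvPar` (GV 2000 Thm. 1.3),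
`greenberg_charValue_rankZero` (Greenberg 1999 Thm. 4.1), `nonempty_modularParametrizationData`,
`exists_isNewformOf` (modularity), `HoffsteinLuo1997_exists_twist_L_one_ne_zero` (Hoffstein–Luo
1997), `GrossZagier1986_thm_I_7_3` (Gross–Zagier 1986), `rank_eq_analyticRank_of_analyticRank_le_one`
(Gross–Zagier–Kolyvagin), and the ONE open hypothesis `hKY_OPEN` — Keller–Yin's rank-one display
(proof of Thm. 4.2.1, arXiv:2402.12781v2 p. 22; `∀`-form of `KellerYin2024.thm421_rankOne_display_OPEN`),
whose unpublished links are KY Thm. 3.0.11 and Thm. 7.0.6.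
[cite: KellerYin2024, Thm. 4.2.1 and its proof (p. 22)] [cite: CastellaEtAl2021, Thm. 5.3.1]
[cite: GreenbergVatsal2000, Thm. (1.3)] -/
theorem bsdp_of_classX1_typeA_of_analyticRank_eq_one_of_KY_OPEN
    (hGV : GreenbergVatsal2000.thm13_charIdeal_eq_of_gvPar) (hGr : greenberg_charValue_rankZero)
    (hmodP : nonempty_modularParametrizationData) (hmod : exists_isNewformOf)
    (hHL : HoffsteinLuo1997_exists_twist_L_one_ne_zero) (hGZ : GrossZagier1986_thm_I_7_3)
    (hGZK : rank_eq_analyticRank_of_analyticRank_le_one)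
    (W : WeierstrassCurve ℚ) [W.IsElliptic] [W.IsGloballyMinimal] (p : ℕ) [Fact p.Prime]
    (hX1 : ClassX1 W p) (hA : ¬ GVPar W p) (hr : W.analyticRank = 1)
    (hKY_OPEN : ∀ (W' : WeierstrassCurve ℚ) [W'.IsElliptic] [W'.IsGloballyMinimal] (p' : ℕ)
        [Fact p'.Prime], p' ≠ 2 → W'.HasGoodReductionAtPrime p' → ¬ W'.HasIrreducibleModPGaloisRep p' →
        W'.analyticRank = 1 →
      ∀ (K : Type) [Field K] [NumberField K], IsImaginaryQuadratic K →
        Odd (NumberField.discr K) → NumberField.discr K < -4 →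
        SatisfiesHeegnerHypothesis (W'.conductorNorm ℤ) K → SatisfiesHeegnerHypothesis p' K →
        (W'.quadraticTwist (NumberField.discr K : ℚ)).entireLFunction 1 ≠ 0 →
      ∀ (Wd : WeierstrassCurve ℚ) [Wd.IsElliptic] [Wd.IsGloballyMinimal],
        (∃ C : VariableChange ℚ, C • Wd = W'.quadraticTwist (NumberField.discr K : ℚ)) →
      ∀ (q qd : ℚ), W'.leadingLCoeff / ((W'.realPeriodRat * W'.regulator : ℝ) : ℂ) = (q : ℂ) →
        Wd.entireLFunction 1 / (Wd.realPeriodRat : ℂ) = (qd : ℂ) →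
        padicValRat p' q - ((padicValNat p' W'.shaOrder : ℤ) + padicValNat p' W'.tamagawaProduct -
            2 * padicValNat p' W'.torsionOrder) =
          -(padicValRat p' qd - ((padicValNat p' Wd.shaOrder : ℤ) + padicValNat p' Wd.tamagawaProduct -
            2 * padicValNat p' Wd.torsionOrder))) :
    BSDp W p :=
  bsdp_of_classX1_of_analyticRank_eq_one_of_KY_OPEN W p hX1 hr hmod hHL hGZ hGZK hKY_OPEN
    (fun K _ _ hK hodd _ _ hsplit hLK Wd _ _ hWd _ ↦
      pPartRankZero_twist_of_not_gvPar hGV hGr hmodP hGZK W p hX1 hA K hK hodd hsplit hLK Wd hWd)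

end Literature.NumberTheory.EllipticCurves.Rank1Residual

end
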